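import Summits.AnomalousDissipation.AnomalousDissipation.Theses.ImpulseGrid

/-!
# Sketch (crux-ideate, ideator 2, round 1) — crux `ImpulseGrid.BoundedEnergyNoLeakGrid`
(stmt-AnomalousDissipation-14350)

First lemmas of the idea card `diophantine-swept-synchronous-states`:

* `BoundedSynchronousFamilies` — the transfer target C⁺: for every grid design, a vanishing-viscosity
  family of CLASSICAL time-periodic ("synchronous", intended period `1/c`) solutions with drift
  datum and a `j`-uniform pointwise kinetic-energy bound.
* `SynchronousWitnessReduction` — the first checkable statement of the line: such a family
  witnesses every clause of the crux at that design (classical ⟹ global Leray–Hopf by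
  `isGlobalLerayHopf_of_isClassicalNSSolutionOn_holds`; pointwise energy cap ⟹ per-`j` sup bound and
  `meanEnergy ≤ 2E`; periodic classical energy balance ⟹ `⟨(f,u)⟩ = ν⟨‖∇u‖²⟩`, in particular the
  no-leak inequality, via `energy_balance_holds` + `meanDissipation_eq_of_periodic`).
* `boundedEnergyNoLeakGrid_of_synchronous` — the composition (pure logic, proved): C⁺ and the
  reduction give the crux BY NAME.
* `BoundedClassicalFamilies` / `ClassicalWitnessReduction` / `boundedEnergyNoLeakGrid_of_classical` — the
  sharper transfer (periodicity dropped: any bounded eternal CLASSICAL family; mean energy equality from the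
  energy balance alone), and `boundedClassicalFamilies_of_synchronous` (periodic ⟹ classical, proved).
* `TriangularConvect` — the exact "triangular lab" identity behind the sweeping mechanism for
  shear designs (pointwise calculus; stated, not proved here).
-/

namespace Summit.AnomalousDissipation.AnomalousDissipation.Cruxes.BoundedEnergyNoLeakGrid.SweptSketch

open MeasureTheory Filter Set
open Literature.Analysis.FunctionSpaces Literature.Analysis.FunctionSpaces.Torus
open Literature.Analysis.FluidPDE Literature.Analysis.FluidPDE.Torus
open Summit.AnomalousDissipation.AnomalousDissipation.Theses.ImpulseGrid

local notation "𝕋³" => UnitAddTorus (Fin 3)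
local notation "E³" => EuclideanSpace ℝ (Fin 3)

/-- Transfer target C⁺ ("bounded synchronous states"): for EVERY grid design (the crux's clause
list, curried identically) there are `ν_j → 0`, periods `τ_j > 0` (intended: the circuit time
`1/c`), and classical solutions `(u_j, p_j)` of NS on all of `ℝ × T³` forced by `Φ•G`, `τ_j`-periodic
in time, with drift datum `∫ u_j 0 = c e₀` and a `j`-uniform POINTWISE kinetic-energy bound. -/
def BoundedSynchronousFamilies : Prop :=
  ∀ (Φ : 𝕋³ → ℝ) (G : 𝕋³ → E³) (c : ℝ), IsSmooth Φ → IsSmooth G →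
    (∀ (s : UnitAddCircle) x, Φ (x + Pi.single (1 : Fin 3) s) = Φ x ∧ Φ (x + Pi.single (2 : Fin 3) s) = Φ x) →
    (∫ x, Φ x = 1) → (∀ (s : UnitAddCircle) x, G (x + Pi.single (0 : Fin 3) s) = G x) → (∀ x, G x 0 = 0) →
    IsSmooth (fun x => Φ x • G x) → IsDivFree (fun x => Φ x • G x) → HasZeroMean (fun x => Φ x • G x) →
    0 < c →
    ∃ (ν : ℕ → ℝ) (τ : ℕ → ℝ) (u : ℕ → ℝ → 𝕋³ → E³) (p : ℕ → ℝ → 𝕋³ → ℝ) (E : ℝ),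
      (∀ j, 0 < ν j) ∧ Tendsto ν atTop (nhds 0) ∧ (∀ j, 0 < τ j) ∧
      (∀ j, IsClassicalNSSolutionOn Set.univ (ν j) (fun _ => fun x => Φ x • G x) (u j) (p j)) ∧
      (∀ j, Function.Periodic (u j) (τ j)) ∧
      (∀ j, ∫ x, u j 0 x = c • EuclideanSpace.single (0 : Fin 3) (1 : ℝ)) ∧
      (∀ j t, kineticEnergy (u j t) ≤ E)

/-- FIRST LEMMA of the line (reduction; provable now from in-tree facts, size S/M): at a fixed
design, a bounded synchronous classical family witnesses the crux's conclusion with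
`u₀ j := u j 0` — global Leray–Hopf from `isGlobalLerayHopf_of_isClassicalNSSolutionOn_holds`,
per-`j` sup-energy and `meanEnergy ≤ 2E` from the pointwise cap, and NO LEAKAGE from the exact
periodic energy balance of classical solutions (`IsClassicalNSSolutionOn.energy_balance_holds`,
`meanDissipation_eq_of_periodic`, `gradNormSq = eGradNormSq.toReal` on smooth fields). -/
def SynchronousWitnessReduction : Prop :=
  ∀ (Φ : 𝕋³ → ℝ) (G : 𝕋³ → E³) (c : ℝ), IsSmooth Φ → IsSmooth G →
    (∀ (s : UnitAddCircle) x, Φ (x + Pi.single (1 : Fin 3) s) = Φ x ∧ Φ (x + Pi.single (2 : Fin 3) s) = Φ x) →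
    (∫ x, Φ x = 1) → (∀ (s : UnitAddCircle) x, G (x + Pi.single (0 : Fin 3) s) = G x) → (∀ x, G x 0 = 0) →
    IsSmooth (fun x => Φ x • G x) → IsDivFree (fun x => Φ x • G x) → HasZeroMean (fun x => Φ x • G x) →
    0 < c →
    (∃ (ν : ℕ → ℝ) (τ : ℕ → ℝ) (u : ℕ → ℝ → 𝕋³ → E³) (p : ℕ → ℝ → 𝕋³ → ℝ) (E : ℝ),
      (∀ j, 0 < ν j) ∧ Tendsto ν atTop (nhds 0) ∧ (∀ j, 0 < τ j) ∧
      (∀ j, IsClassicalNSSolutionOn Set.univ (ν j) (fun _ => fun x => Φ x • G x) (u j) (p j)) ∧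
      (∀ j, Function.Periodic (u j) (τ j)) ∧
      (∀ j, ∫ x, u j 0 x = c • EuclideanSpace.single (0 : Fin 3) (1 : ℝ)) ∧
      (∀ j t, kineticEnergy (u j t) ≤ E)) →
    ∃ (ν : ℕ → ℝ) (u₀ : ℕ → 𝕋³ → E³) (u : ℕ → ℝ → 𝕋³ → E³),
      (∀ j, 0 < ν j) ∧ Filter.Tendsto ν Filter.atTop (nhds 0) ∧
      (∀ j, IsGlobalLerayHopf (ν j) (fun _ => fun x => Φ x • G x) (u₀ j) (u j)) ∧
      (∀ j, ∃ C : ℝ, ∀ t : ℝ, 0 ≤ t → kineticEnergy (u j t) ≤ C) ∧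
      (∀ j, ∫ x, u₀ j x = c • EuclideanSpace.single 0 1) ∧
      (∃ E : ℝ, ∀ j, meanEnergy (u j) ≤ E) ∧
      (∀ j, longTimeAvgSup (fun t => ∫ x, inner ℝ (Φ x • G x) (u j t x)) ≤ meanDissipation (ν j) (u j))

/-- Composition (pure logic): the transfer target and the reduction give the crux BY NAME. -/
theorem boundedEnergyNoLeakGrid_of_synchronous
    (hR : SynchronousWitnessReduction) (hB : BoundedSynchronousFamilies) :
    BoundedEnergyNoLeakGrid := by
  intro Φ G c h1 h2 h3 h4 h5 h6 h7 h8 h9 h10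
  exact hR Φ G c h1 h2 h3 h4 h5 h6 h7 h8 h9 h10 (hB Φ G c h1 h2 h3 h4 h5 h6 h7 h8 h9 h10)


/-- Sharper transfer target C⁺′ ("bounded classical families"; periodicity dropped): for EVERY grid design
there are `ν_j → 0` and classical solutions `(u_j, p_j)` of NS on all of `ℝ × T³` forced by `Φ•G` with drift
datum `∫ u_j 0 = c e₀` and a `j`-uniform pointwise kinetic-energy bound for `t ≥ 0`. Intended witnesses:
synchronous (1/c-periodic) or quasi-periodic swept states; any eternal smooth bounded solution qualifies. -/
def BoundedClassicalFamilies : Prop :=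
  ∀ (Φ : 𝕋³ → ℝ) (G : 𝕋³ → E³) (c : ℝ), IsSmooth Φ → IsSmooth G →
    (∀ (s : UnitAddCircle) x, Φ (x + Pi.single (1 : Fin 3) s) = Φ x ∧ Φ (x + Pi.single (2 : Fin 3) s) = Φ x) →
    (∫ x, Φ x = 1) → (∀ (s : UnitAddCircle) x, G (x + Pi.single (0 : Fin 3) s) = G x) → (∀ x, G x 0 = 0) →
    IsSmooth (fun x => Φ x • G x) → IsDivFree (fun x => Φ x • G x) → HasZeroMean (fun x => Φ x • G x) →
    0 < c →
    ∃ (ν : ℕ → ℝ) (u : ℕ → ℝ → 𝕋³ → E³) (p : ℕ → ℝ → 𝕋³ → ℝ) (E : ℝ),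
      (∀ j, 0 < ν j) ∧ Tendsto ν atTop (nhds 0) ∧
      (∀ j, IsClassicalNSSolutionOn Set.univ (ν j) (fun _ => fun x => Φ x • G x) (u j) (p j)) ∧
      (∀ j, ∫ x, u j 0 x = c • EuclideanSpace.single (0 : Fin 3) (1 : ℝ)) ∧
      (∀ j t, 0 ≤ t → kineticEnergy (u j t) ≤ E)

/-- FIRST LEMMA, sharper form (provable now, S/M): a bounded classical family witnesses the crux at its design.
No periodicity is needed for the no-leak clause: for a classical solution `t ↦ KE(u t)` has derivative
`-ν‖∇u‖² + (f,u)` (`energy_balance_holds`), so the Cesàro means of `(f,u)` and of `ν‖∇u‖²` differ by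
`(KE(u T) - KE(u 0))/T → 0` when `KE ≤ E`, and their `limsup`s coincide (`longTimeAvgSup`): mean energy
EQUALITY, in particular `longTimeAvgSup (f,u) ≤ meanDissipation`. -/
def ClassicalWitnessReduction : Prop :=
  ∀ (Φ : 𝕋³ → ℝ) (G : 𝕋³ → E³) (c : ℝ), IsSmooth Φ → IsSmooth G →
    (∀ (s : UnitAddCircle) x, Φ (x + Pi.single (1 : Fin 3) s) = Φ x ∧ Φ (x + Pi.single (2 : Fin 3) s) = Φ x) →
    (∫ x, Φ x = 1) → (∀ (s : UnitAddCircle) x, G (x + Pi.single (0 : Fin 3) s) = G x) → (∀ x, G x 0 = 0) →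
    IsSmooth (fun x => Φ x • G x) → IsDivFree (fun x => Φ x • G x) → HasZeroMean (fun x => Φ x • G x) →
    0 < c →
    (∃ (ν : ℕ → ℝ) (u : ℕ → ℝ → 𝕋³ → E³) (p : ℕ → ℝ → 𝕋³ → ℝ) (E : ℝ),
      (∀ j, 0 < ν j) ∧ Tendsto ν atTop (nhds 0) ∧
      (∀ j, IsClassicalNSSolutionOn Set.univ (ν j) (fun _ => fun x => Φ x • G x) (u j) (p j)) ∧
      (∀ j, ∫ x, u j 0 x = c • EuclideanSpace.single (0 : Fin 3) (1 : ℝ)) ∧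
      (∀ j t, 0 ≤ t → kineticEnergy (u j t) ≤ E)) →
    ∃ (ν : ℕ → ℝ) (u₀ : ℕ → 𝕋³ → E³) (u : ℕ → ℝ → 𝕋³ → E³),
      (∀ j, 0 < ν j) ∧ Filter.Tendsto ν Filter.atTop (nhds 0) ∧
      (∀ j, IsGlobalLerayHopf (ν j) (fun _ => fun x => Φ x • G x) (u₀ j) (u j)) ∧
      (∀ j, ∃ C : ℝ, ∀ t : ℝ, 0 ≤ t → kineticEnergy (u j t) ≤ C) ∧
      (∀ j, ∫ x, u₀ j x = c • EuclideanSpace.single 0 1) ∧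
      (∃ E : ℝ, ∀ j, meanEnergy (u j) ≤ E) ∧
      (∀ j, longTimeAvgSup (fun t => ∫ x, inner ℝ (Φ x • G x) (u j t x)) ≤ meanDissipation (ν j) (u j))

/-- Composition (pure logic): the sharper transfer target and its reduction give the crux BY NAME. -/
theorem boundedEnergyNoLeakGrid_of_classical
    (hR : ClassicalWitnessReduction) (hB : BoundedClassicalFamilies) :
    BoundedEnergyNoLeakGrid := by
  intro Φ G c h1 h2 h3 h4 h5 h6 h7 h8 h9 h10
  exact hR Φ G c h1 h2 h3 h4 h5 h6 h7 h8 h9 h10 (hB Φ G c h1 h2 h3 h4 h5 h6 h7 h8 h9 h10)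

/-- The periodic target is a special case of the classical one (pure logic). -/
theorem boundedClassicalFamilies_of_synchronous (hB : BoundedSynchronousFamilies) :
    BoundedClassicalFamilies := by
  intro Φ G c h1 h2 h3 h4 h5 h6 h7 h8 h9 h10
  obtain ⟨ν, τ, u, p, E, hν, hν0, _hτ, hcl, _hper, hmean, hE⟩ := hB Φ G c h1 h2 h3 h4 h5 h6 h7 h8 h9 h10
  exact ⟨ν, u, p, E, hν, hν0, hcl, hmean, fun j t _ => hE j t⟩

/-- The "triangular lab" (exact, pointwise): for a field `u = c•e₀ + S•e₁ + R•e₂` on `T³` with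
`S` a function of `x₀` only and `R` a function of `(x₀,x₁)` only, the convective term is
`(c ∂₀S)•e₁ + (c ∂₀R + S ∂₁R)•e₂` and `u` is divergence free — so for a SHEAR design
`f = Φ(x₀) g(x₁) e₂` the Navier–Stokes system closes on the two LINEAR advection–diffusion equations
`∂ₜS + c∂₀S = ν∂₀²S`, `∂ₜR + c∂₀R + S∂₁R = ν(∂₀² + ∂₁²)R + Φ g` with zero pressure (the sweeping
shear `S` is exactly unforced: the maintenance problem of the card in its sharpest form). -/
def TriangularConvect : Prop :=
  ∀ (S R : 𝕋³ → ℝ) (c : ℝ), IsSmooth S → IsSmooth R →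
    (∀ (s : UnitAddCircle) x, S (x + Pi.single (1 : Fin 3) s) = S x ∧ S (x + Pi.single (2 : Fin 3) s) = S x) →
    (∀ (s : UnitAddCircle) x, R (x + Pi.single (2 : Fin 3) s) = R x) →
    let u : 𝕋³ → E³ := fun x =>
      c • EuclideanSpace.single (0 : Fin 3) (1 : ℝ) + S x • EuclideanSpace.single (1 : Fin 3) (1 : ℝ) +
        R x • EuclideanSpace.single (2 : Fin 3) (1 : ℝ)
    IsDivFree u ∧
      ∀ x, convect u u x =
        (c * partialDeriv 0 S x) • EuclideanSpace.single (1 : Fin 3) (1 : ℝ) +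
          (c * partialDeriv 0 R x + S x * partialDeriv 1 R x) • EuclideanSpace.single (2 : Fin 3) (1 : ℝ)

end Summit.AnomalousDissipation.AnomalousDissipation.Cruxes.BoundedEnergyNoLeakGrid.SweptSketch
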